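import Summits.Ventures.PercRepro.ThetaSigmaReducible

/-!
# (Σ): the credit at a point with few partners

Dossier proofs/MINE1-theoremS.md, Addendum 76 (mine-1, gen 39), the per-point case analysis. At a
point `e` of a valid (Σ)-instance the credit `creditS U e X` (the `e`-edges of the family) pays
the consistent partner pairs whenever there are at most two of them:

* `one_le_card_creditS_of_partner` — one partner pair `x, x + e` and any third member `y` give an
  `e`-edge: `x ∩ y`, `(x + e) ∩ y` if `e ∈ y`, the two co-joins if `e ∉ y`;
* `two_le_card_creditS_of_partners` — two partner pairs `x₁, x₁ + e` and `x₂, x₂ + e` give the two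
  distinct `e`-edges at `x₁ ∩ x₂` and `U ∖ (x₁ ∪ x₂ ∪ e)` (distinct by validity);
* `card_partS_le_card_creditS_of_le_two` — hence `|partS e X| ≤ |creditS U e X|` whenever
  `|partS e X| ≤ 2` (with a third member when there is exactly one partner pair);
* `sigmaReducible_of_consistent_le_two` — so at a sign-consistent point with at most two partner
  pairs, reducibility of the projection gives reducibility of the instance.

With these, the consistent-point induction of ThetaSigmaReducible.lean needs an assumption on the
partner family only from three partner pairs on — where (Σ) for the partner family plus `{e}` in
the family (or strictness) takes over (`card_partS_le_card_creditS_of`).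
-/

namespace PercRepro.MSTight

open Finset

variable {α : Type*} [DecidableEq α] [Fintype α]

section CreditSmall

variable {U : Finset α} {e : α} {X : Finset (Finset α)}

omit [Fintype α] in
/-- The `e`-free part of a relative co-join: `U ∖ (insert e x ∪ y) = (U ∖ (x ∪ y)).erase e`. -/
theorem sdiff_insert_sup_eq_erase (x y : Finset α) :
    U \ (insert e x ⊔ y) = (U \ (x ⊔ y)).erase e := by
  ext a
  simp only [sup_eq_union, mem_sdiff, mem_union, mem_insert, mem_erase]
  tauto

omit [Fintype α] in
/-- **One partner pair and a third member give an `e`-edge.** -/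
theorem one_le_card_creditS_of_partner (hU : e ∈ U) {x y : Finset α} (hx : x ∈ partS e X)
    (hy : y ∈ X) (hyx : y ≠ x) (hye : y ≠ insert e x) : 1 ≤ (creditS U e X).card := by
  obtain ⟨hxX, hex, hxeX⟩ := mem_partS.1 hx
  rw [Nat.one_le_iff_ne_zero, Ne, card_eq_zero, ← Ne, ← nonempty_iff_ne_empty]
  by_cases hey : e ∈ y
  · -- the edge at `x ∩ y`
    refine ⟨x ⊓ y, mem_creditS.2 ⟨inf_mem_sigmaD hyx.symm hxX hy, fun h => hex (mem_inter.1 h).1,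
      ?_⟩⟩
    have hm := inf_mem_sigmaD (U := U) hye.symm hxeX hy
    rwa [inf_eq_inter, insert_inter_of_mem hey, ← inf_eq_inter] at hm
  · -- the edge at `U ∖ (x ∪ y ∪ e)`
    refine ⟨U \ (insert e x ⊔ y), mem_creditS.2 ⟨sdiff_sup_mem_sigmaD hye.symm hxeX hy,
      fun h => (mem_sdiff.1 h).2 (mem_union_left y (mem_insert_self e x)), ?_⟩⟩
    rw [sdiff_insert_sup_eq_erase, insert_erase (by
      simp only [sup_eq_union, mem_sdiff, mem_union, not_or]
      exact ⟨hU, hex, hey⟩)]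
    exact sdiff_sup_mem_sigmaD hyx.symm hxX hy

omit [Fintype α] in
/-- **Two partner pairs give two distinct `e`-edges**: at `x₁ ∩ x₂` and at `U ∖ (x₁ ∪ x₂ ∪ e)`. -/
theorem two_le_card_creditS_of_partners (hU : e ∈ U) (hv : SigmaValidRel U X) {x₁ x₂ : Finset α}
    (hx₁ : x₁ ∈ partS e X) (hx₂ : x₂ ∈ partS e X) (hne : x₁ ≠ x₂) :
    2 ≤ (creditS U e X).card := by
  obtain ⟨hx₁X, hex₁, hx₁eX⟩ := mem_partS.1 hx₁
  obtain ⟨hx₂X, hex₂, hx₂eX⟩ := mem_partS.1 hx₂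
  have hne' : insert e x₁ ≠ insert e x₂ := fun h => hne (by
    have h1 : (insert e x₁).erase e = (insert e x₂).erase e := by rw [h]
    rwa [erase_insert hex₁, erase_insert hex₂] at h1)
  -- the meet edge
  have hα : x₁ ⊓ x₂ ∈ creditS U e X := by
    refine mem_creditS.2 ⟨inf_mem_sigmaD hne hx₁X hx₂X, fun h => hex₁ (mem_inter.1 h).1, ?_⟩
    have hm := inf_mem_sigmaD (U := U) hne' hx₁eX hx₂eX
    rwa [inf_eq_inter, ← insert_inter_distrib, ← inf_eq_inter] at hm
  -- the co-join edge
  have hδ : U \ (insert e x₁ ⊔ insert e x₂) ∈ creditS U e X := by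
    refine mem_creditS.2 ⟨sdiff_sup_mem_sigmaD hne' hx₁eX hx₂eX,
      fun h => (mem_sdiff.1 h).2 (mem_union_left _ (mem_insert_self e x₁)), ?_⟩
    have hrw : U \ (insert e x₁ ⊔ insert e x₂) = (U \ (x₁ ⊔ x₂)).erase e := by
      ext a
      simp only [sup_eq_union, mem_sdiff, mem_union, mem_insert, mem_erase]
      tauto
    rw [hrw, insert_erase (by
      simp only [sup_eq_union, mem_sdiff, mem_union, not_or]
      exact ⟨hU, hex₁, hex₂⟩)]
    exact sdiff_sup_mem_sigmaD hne hx₁X hx₂X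
  -- the two edges are distinct: `x₁ ∩ x₂ ⊆ x₁` while the co-join avoids `x₁`; both empty would
  -- make `insert e x₂ = U ∖ x₁`, against validity
  have hαδ : x₁ ⊓ x₂ ≠ U \ (insert e x₁ ⊔ insert e x₂) := by
    intro h
    have hαe : x₁ ⊓ x₂ = ∅ := by
      rw [eq_empty_iff_forall_notMem]
      intro a ha
      have ha' : a ∈ U \ (insert e x₁ ⊔ insert e x₂) := h ▸ ha
      exact (mem_sdiff.1 ha').2 (mem_union_left _ (mem_insert_of_mem (mem_inter.1 ha).1))
    have hδe : U \ (insert e x₁ ⊔ insert e x₂) = ∅ := h ▸ hαe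
    -- then `insert e x₂ = U ∖ x₁`
    have hcomp : U \ x₁ = insert e x₂ := by
      ext a
      constructor
      · intro ha
        obtain ⟨haU, hax₁⟩ := mem_sdiff.1 ha
        by_contra hh
        have : a ∈ U \ (insert e x₁ ⊔ insert e x₂) := by
          rw [mem_sdiff, sup_eq_union, mem_union, mem_insert, mem_insert]
          refine ⟨haU, ?_⟩
          rintro ((rfl | h1) | h2)
          · exact hh (mem_insert_self _ _)
          · exact hax₁ h1
          · exact hh (mem_insert.2 h2)
        rw [hδe] at this
        exact notMem_empty a this
      · intro ha
        rw [mem_insert] at ha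
        rcases ha with rfl | ha
        · exact mem_sdiff.2 ⟨hU, hex₁⟩
        · refine mem_sdiff.2 ⟨hv.1 x₂ hx₂X ha, fun h1 => ?_⟩
          have : a ∈ x₁ ⊓ x₂ := mem_inter.2 ⟨h1, ha⟩
          rw [hαe] at this
          exact notMem_empty a this
    exact sdiff_notMem_of_sigmaValidRel hv hx₁X (hcomp ▸ hx₂eX)
  calc 2 = ({x₁ ⊓ x₂, U \ (insert e x₁ ⊔ insert e x₂)} : Finset (Finset α)).card := by
        rw [card_pair hαδ]
    _ ≤ (creditS U e X).card := card_le_card (by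
        intro d hd
        rw [mem_insert, mem_singleton] at hd
        rcases hd with rfl | rfl
        · exact hα
        · exact hδ)

omit [Fintype α] in
/-- **At most two partner pairs are paid by the credit** (a third member is needed when there is
exactly one). -/
theorem card_partS_le_card_creditS_of_le_two (hU : e ∈ U) (hv : SigmaValidRel U X)
    (h2 : (partS e X).card ≤ 2) (h3 : (partS e X).card = 1 → 3 ≤ X.card) :
    (partS e X).card ≤ (creditS U e X).card := by
  rcases Nat.lt_or_ge (partS e X).card 1 with h0 | h1
  · omega
  rcases Nat.lt_or_ge (partS e X).card 2 with hlt | hge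
  · -- exactly one partner pair `x`: a third member exists
    have hc : (partS e X).card = 1 := by omega
    obtain ⟨x, hx⟩ := card_eq_one.1 hc
    have hxP : x ∈ partS e X := hx ▸ mem_singleton_self x
    obtain ⟨hxX, hex, hxeX⟩ := mem_partS.1 hxP
    -- a member other than `x` and `x + e`
    have : ∃ y ∈ X, y ≠ x ∧ y ≠ insert e x := by
      by_contra hcon
      have hsub : X ⊆ {x, insert e x} := fun y hy => by
        rw [mem_insert, mem_singleton]
        by_contra hh
        exact hcon ⟨y, hy, fun h => hh (Or.inl h), fun h => hh (Or.inr h)⟩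
      have := (card_le_card hsub).trans (card_le_two)
      omega
    obtain ⟨y, hy, hyx, hye⟩ := this
    rw [hc]
    exact one_le_card_creditS_of_partner hU hxP hy hyx hye
  · -- exactly two partner pairs
    have hc : (partS e X).card = 2 := by omega
    obtain ⟨x₁, x₂, hne, hx⟩ := card_eq_two.1 hc
    have hx₁ : x₁ ∈ partS e X := hx ▸ mem_insert_self _ _
    have hx₂ : x₂ ∈ partS e X := hx ▸ mem_insert_of_mem (mem_singleton_self _)
    rw [hc]
    exact two_le_card_creditS_of_partners hU hv hx₁ hx₂ hne

omit [Fintype α] in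
/-- **Reducibility through a sign-consistent point with at most two partner pairs.** -/
theorem sigmaReducible_of_consistent_le_two (hU : e ∈ U) (hv : SigmaValidRel U X)
    (hc : SigmaConsistentAt U e X) (h2 : (partS e X).card ≤ 2)
    (h3 : (partS e X).card = 1 → 3 ≤ X.card) (hP : SigmaReducible (U.erase e) (projS e X)) :
    SigmaReducible U X :=
  SigmaReducible.step e hU hc hP (card_partS_le_card_creditS_of_le_two hU hv h2 h3)

end CreditSmall

end PercRepro.MSTight
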